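import Summits.BirchSwinnertonDyer.BirchSwinnertonDyer.Theorems.GenusKolyvaginAtTwoMinimalTwinBSDTwoTamagawaSlices
import Summits.BirchSwinnertonDyer.BirchSwinnertonDyer.Theorems.GenusKolyvaginAtTwoMinimalTwinBSDTwoSwappedPairOneBitPrime
import HarnessLib

/-!
# Route `GenusKolyvaginAtTwo` (rev 53): THE ROUTE LEDGER WITH THE RANK-ONE INPUT U₂ `MinimalTwinBSDTwo` (stmt-BirchSwinnertonDyer-22985)
# REPLACED BY THE RANK-ZERO WALL S1 AND TWO REVERSED `2`-SELMER-TRIVIAL HEEGNER TWIN SUPPLIES (Δ > 0: LINE 23 v1.3's S2″; Δ < 0: S2⁻′)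

Seat `bsd-line-gk2-p3` g28 (PROVER seat 3/3, cell `bsd-f1-sign2`), `--supports stmt-BirchSwinnertonDyer-22985` (helper; closes nothing).
THEOREMS ONLY (no definition, no named fact, no `sorry`); standard axioms.  **BSD is NOT proved by this file; U₂ is NOT proved; no item is closed.**
The theorems are CONDITIONAL on their displayed hypotheses — the route's items (as `closes` is), LINE 23's anchor S1 (`MinimalRankZeroBSDTwo`,
pen v1.1 / WALL row 1 by the door `minimalRankZeroBSDTwo_of_wall`), and the two reversed supplies (beyond print as supply statements) — i.e.
bookkeeping BY NAME of what this seat and gk2-p2 g23 landed today.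

* §1 **`hTw0_of_wall_of_reversedSupplyExponent_of_facts`** — the `Δ > 0` cell: **`hTw0 ⟸ S1 + S2″ + PRINT`**, S2″ = LINE 23 v1.3's
  `ReversedMinimalSupplyAtTwoExponent` VERBATIM (gk2-p2 g23, memo `Lines/twin-swap-s3prime-gk2p2.md` §5; Manin-free exponent clause
  `2^(ord₂ c) ∥ P(1)`); engine = g23's `TwinSwap.swappedPairDescentAtTwo_maninExponent_of_facts` (p766443) BY NAME.
* §2 **`nonCMAtTwo_of_items_of_wall_of_reversedSupplies`** — the deciding composition of the route with `hTw` REPLACED by `S1 + S2″ + S2⁻′`: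
  this seat's `Slices.nonCMAtTwo_of_items_of_tamagawaSlicedTwin` (p766209) with `hTw0` from §1 and `hTw1` from
  `OneBit.hTw1_of_wall_of_reversedSupplyDepthOnePrime_of_facts` (p767140; prime Heegner field, depth `ord₂ c + 1`).  So, modulo the route's
  other items, **the rank-one input of `closes` is «WALL row 1 on `2`-Selmer-trivial curves + two reversed supplies»**, each supply a pure
  ∃-statement about ONE Heegner field per curve (instrument-shaped), with lossless exponent clauses (p765721/p766364/p766822).

References: [GrossZagier1986] V.§2 (2.2); [GrossLMS1991] §5 Prop. 5.3; [Milne1972ArithmeticAV] §1 Thm. 1; [Kramer1981] Thm. 1, §2 Prop. 3;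
[Miller2011LMS] Def. 1.1.
-/

set_option autoImplicit false
set_option linter.dupNamespace false -- `Summit.<P>.<Sub>` repeats `BirchSwinnertonDyer` (D-0017)

noncomputable section

open scoped Classical

open WeierstrassCurve NumberField Literature.NumberTheory.EllipticCurves
  Literature.NumberTheory.EllipticCurves.ModularForms
  Literature.NumberTheory.EllipticCurves.Rank1Residual
  Literature.NumberTheory.EllipticCurves.Rank1Residual.Typed
  Literature.NumberTheory.EllipticCurves.KrizLi2019
  Summit.BirchSwinnertonDyer.Rank1Residual
  Summit.BirchSwinnertonDyer.Rank1Residual.AdditivePotMult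
  Summit.BirchSwinnertonDyer.BirchSwinnertonDyer.Rank1Residual
  Summit.BirchSwinnertonDyer.BirchSwinnertonDyer.Theses.GenusKolyvaginAtTwo
  Summit.BirchSwinnertonDyer.BirchSwinnertonDyer.Theorems.CMExactDescent
  Summit.BirchSwinnertonDyer.BirchSwinnertonDyer.Theorems.GenusExact.TwinSwap
  Summit.BirchSwinnertonDyer.BirchSwinnertonDyer.Theorems.GenusExact.TwinSwap.OneBit

namespace Summit.BirchSwinnertonDyer.BirchSwinnertonDyer.Theorems.GenusExact.TwinSwap.Ledger

/-! ## §1 The `Δ > 0` cell `hTw0` from the wall, LINE 23 v1.3's reversed supply S2″ and PRINT -/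

/-- **`hTw0 ⟸ S1 + S2″ + PRINT`.**  With `hS1` — LINE 23's anchor (`MinimalRankZeroBSDTwo` verbatim) — and `hS2e` — LINE 23 v1.3's
`ReversedMinimalSupplyAtTwoExponent` VERBATIM (for `W` non-CM, `r_an = 1`, `#Sel₂ = 2`, `C(W)` odd: a Heegner field `K` with `d_K` odd `≠ −3`,
a datum with `c ≠ 0`, `P(1)` of infinite order with `2^(ord₂ c) ∥ P(1)`, a globally minimal `2`-Selmer-trivial twin inside the budget) and the four
PRINT facts: **every `W` on `hTw0 = (Δ > 0, ord₂ C(W) = 0)` satisfies `BSD₂`** (the binder `hTw0` of `Slices.nonCMAtTwo_of_items_of_tamagawaSlicedTwin`).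
Engine: g23's `swappedPairDescentAtTwo_maninExponent_of_facts` (p766443) BY NAME; the twin's `r_an = 0` by g23's `analyticRank_twist_eq_zero_of_rankOne`,
its non-CM by `j`.  CONDITIONAL on the displayed hypotheses; BSD is NOT proved; nothing is closed.
[cite: GrossZagier1986, V.§2 (2.2)] [cite: Milne1972ArithmeticAV, §1 Thm. 1] [cite: Miller2011LMS, Def. 1.1] -/
theorem hTw0_of_wall_of_reversedSupplyExponent_of_facts
    (hGZ : ∀ (N : ℕ) [NeZero N] (W : WeierstrassCurve ℚ) (K : Type) [Field K] [NumberField K], gross_zagier N W K)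
    (hGZK : rank_eq_analyticRank_of_analyticRank_le_one) (hmod : hasEntireLFunction_rat)
    (hMilneC : Milne1972.bsdQuotient_baseChange_quadratic_anyModel)
    (hS1 : ∀ (W : WeierstrassCurve ℚ) [W.IsElliptic] [W.IsGloballyMinimal],
      ¬ W.HasCM → W.analyticRank = 0 → Nat.card (W.selmerGroup 2) = 1 → BSDp W 2)
    (hS2e : ∀ (W : WeierstrassCurve ℚ) [W.IsElliptic] [W.IsGloballyMinimal] [NeZero (W.conductorNorm ℤ)],
      ¬ W.HasCM → W.analyticRank = 1 → Nat.card (W.selmerGroup 2) = 2 → Odd W.tamagawaProduct →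
      ∃ (K : Type) (_ : Field K) (_ : NumberField K),
        IsImaginaryQuadratic K ∧ Odd (NumberField.discr K) ∧ NumberField.discr K ≠ -3 ∧ SatisfiesHeegnerHypothesis (W.conductorNorm ℤ) K ∧
        ∃ (Dt : ModularParametrizationData W (W.conductorNorm ℤ)) (β : ℤ) (ι : K →+* ℂ) (d₁ : KolyvaginHeegnerData Dt β ι 1),
          Dt.c ≠ 0 ∧ ¬ IsOfFinAddOrder d₁.derivedPoint ∧
          (∃ M₀ : ℕ, padicValInt 2 Dt.c = M₀ ∧
            (∃ Q : (W.baseChange (ringClassField K ι 1)).toAffine.Point, ((2 ^ M₀ : ℕ) : ℤ) • Q = d₁.derivedPoint) ∧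
            (¬ ∃ Q : (W.baseChange (ringClassField K ι 1)).toAffine.Point, ((2 ^ (M₀ + 1) : ℕ) : ℤ) • Q = d₁.derivedPoint)) ∧
          ∃ (Wd : WeierstrassCurve ℚ) (_ : Wd.IsElliptic) (_ : Wd.IsGloballyMinimal),
            (∃ C : VariableChange ℚ, C • W.quadraticTwist (NumberField.discr K : ℚ) = Wd) ∧ Nat.card (Wd.selmerGroup 2) = 1 ∧
            ((W.Δ < 0 ∧ padicValNat 2 Wd.tamagawaProduct ≤ 1) ∨ padicValNat 2 Wd.tamagawaProduct = 0)) :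
    ∀ (W : WeierstrassCurve ℚ) [W.IsElliptic] [W.IsGloballyMinimal], ¬ W.HasCM → W.analyticRank = 1 →
      Nat.card (W.selmerGroup 2) = 2 → 0 < W.Δ → padicValNat 2 W.tamagawaProduct = 0 → BSDp W 2 := by
  intro W _ _ hcm hr hSel _hΔ hC0
  haveI : NeZero (W.conductorNorm ℤ) := ⟨(W.conductorNorm_pos_holds).ne'⟩
  have hT : Odd W.tamagawaProduct := by
    rcases Nat.even_or_odd W.tamagawaProduct with h | h
    · exfalso
      have h2 : 2 ∣ W.tamagawaProduct := even_iff_two_dvd.mp h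
      have h1 : 1 ≤ padicValNat 2 W.tamagawaProduct :=
        one_le_padicValNat_of_dvd W.tamagawaProduct_pos_holds.ne' h2
      omega
    · exact h
  obtain ⟨K, iF, iN, hK, hodd, h3, hH, Dt, β, ι, d₁, hc0, hy, ⟨M₀, hcM, hdiv, hndiv⟩, Wd, iE, iM, hWd, hSel1, hbudget⟩ :=
    hS2e W hcm hr hSel hT
  haveI hEK : (W.baseChange K).IsElliptic := isElliptic_baseChange' W K
  have hD0 : (NumberField.discr K : ℚ) ≠ 0 := by exact_mod_cast NumberField.discr_ne_zero K
  haveI hEt : (W.quadraticTwist (NumberField.discr K : ℚ)).IsElliptic := W.isElliptic_quadraticTwist hD0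
  obtain ⟨Cd, hCd⟩ := hWd
  -- the twin is non-CM (same `j`) of analytic rank `0`: `BSD₂(Wd)` from S1
  have hcmd : ¬ Wd.HasCM := by
    rw [← hCd, hasCM_iff_of_j_eq (((W.quadraticTwist (NumberField.discr K : ℚ)).variableChange_j Cd).trans (W.j_quadraticTwist hD0))]
    exact hcm
  obtain ⟨P₀, Hd, hP₀, hP₀K⟩ := exists_heegnerPoint_map_eq_derivedPoint_one hK hH d₁
  have hPinf : ¬ IsOfFinAddOrder P₀ := by
    intro hfin
    apply hy
    rw [← hP₀K]
    exact (WeierstrassCurve.Affine.Point.map (W' := W)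
      (algebraMap K (ringClassField K ι 1)).toRatAlgHom).isOfFinAddOrder hfin
  have hrt : (W.quadraticTwist (NumberField.discr K : ℚ)).analyticRank = 0 :=
    analyticRank_twist_eq_zero_of_rankOne W K (hGZ _ W K) hmod hK hH hr ⟨Dt, Hd, ι, hP₀⟩ hPinf
  have hrd : Wd.analyticRank = 0 := by rw [← hCd, analyticRank_smul, hrt]
  have hBd : BSDp Wd 2 := hS1 Wd hcmd hrd hSel1
  exact swappedPairDescentAtTwo_maninExponent_of_facts hGZ hGZK hmod hMilneC W hr hSel hT K hK hodd h3 hH Dt hc0 β ι d₁ hy M₀ hcM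
    hdiv hndiv Wd ⟨Cd, hCd⟩ hSel1 hbudget hBd

/-! ## §2 The deciding composition with U₂ replaced by S1 and the two reversed supplies -/

/-- **THE ROUTE LEDGER WITH U₂ REPLACED BY «WALL + TWO REVERSED SUPPLIES».**  The deciding theorem `GenusKolyvaginAtTwo.closes` (rev 53) with its
binder `hTw : MinimalTwinBSDTwo` replaced by: `hS1` (LINE 23's anchor, the rank-`0` wall on `2`-Selmer-trivial curves), `hS2e` (LINE 23 v1.3's S2″,
verbatim — serves the `Δ > 0` cell `hTw0` via §1) and `hS2p` (S2⁻′, the prime-frame reversed supply at depth `ord₂ c + 1` — serves the `Δ < 0` cell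
`hTw1` via `OneBit.hTw1_of_wall_of_reversedSupplyDepthOnePrime_of_facts`, p767140); all other binders = the route's items, as in `closes`; the
slicing is this seat's `Slices.nonCMAtTwo_of_items_of_tamagawaSlicedTwin` (p766209).  CONDITIONAL on the displayed hypotheses (route items, the
wall, two supplies beyond print as stated); proves nothing about BSD by itself; closes no item.
[cite: GrossZagier1986, V.§2 (2.2)] [cite: Kramer1981, Thm. 1, §2 Prop. 3] [cite: Miller2011LMS, Def. 1.1] -/
theorem nonCMAtTwo_of_items_of_wall_of_reversedSupplies
    (hP : GenusPrimitiveSupplyAtTwoPosDiscShallow) (hPG : GenusDeepSupplyAtTwoNegDiscNarrow) (hQ1 : CyclicTorsionOfNegDisc)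
    (hQ2 : KolyvaginRelationAtTwo)
    (hQ5R : EquivariantChebotarevAtTwoR) (hQ3RT : EquivariantKolyvaginExactAtTwoRT)
    (hQ4T : KolyvaginExactAtTwoPosDiscT) (hGf : ExactDescentAtTwoOfFourFacts)
    (hR : OffHabitatResidualAtTwo) (hOff : OffCutResidualAtTwo)
    (hS1 : ∀ (W : WeierstrassCurve ℚ) [W.IsElliptic] [W.IsGloballyMinimal],
      ¬ W.HasCM → W.analyticRank = 0 → Nat.card (W.selmerGroup 2) = 1 → BSDp W 2)
    (hS2e : ∀ (W : WeierstrassCurve ℚ) [W.IsElliptic] [W.IsGloballyMinimal] [NeZero (W.conductorNorm ℤ)],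
      ¬ W.HasCM → W.analyticRank = 1 → Nat.card (W.selmerGroup 2) = 2 → Odd W.tamagawaProduct →
      ∃ (K : Type) (_ : Field K) (_ : NumberField K),
        IsImaginaryQuadratic K ∧ Odd (NumberField.discr K) ∧ NumberField.discr K ≠ -3 ∧ SatisfiesHeegnerHypothesis (W.conductorNorm ℤ) K ∧
        ∃ (Dt : ModularParametrizationData W (W.conductorNorm ℤ)) (β : ℤ) (ι : K →+* ℂ) (d₁ : KolyvaginHeegnerData Dt β ι 1),
          Dt.c ≠ 0 ∧ ¬ IsOfFinAddOrder d₁.derivedPoint ∧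
          (∃ M₀ : ℕ, padicValInt 2 Dt.c = M₀ ∧
            (∃ Q : (W.baseChange (ringClassField K ι 1)).toAffine.Point, ((2 ^ M₀ : ℕ) : ℤ) • Q = d₁.derivedPoint) ∧
            (¬ ∃ Q : (W.baseChange (ringClassField K ι 1)).toAffine.Point, ((2 ^ (M₀ + 1) : ℕ) : ℤ) • Q = d₁.derivedPoint)) ∧
          ∃ (Wd : WeierstrassCurve ℚ) (_ : Wd.IsElliptic) (_ : Wd.IsGloballyMinimal),
            (∃ C : VariableChange ℚ, C • W.quadraticTwist (NumberField.discr K : ℚ) = Wd) ∧ Nat.card (Wd.selmerGroup 2) = 1 ∧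
            ((W.Δ < 0 ∧ padicValNat 2 Wd.tamagawaProduct ≤ 1) ∨ padicValNat 2 Wd.tamagawaProduct = 0))
    (hS2p : ∀ (W : WeierstrassCurve ℚ) [W.IsElliptic] [W.IsGloballyMinimal] [NeZero (W.conductorNorm ℤ)],
      ¬ W.HasCM → W.analyticRank = 1 → Nat.card (W.selmerGroup 2) = 2 → W.Δ < 0 → padicValNat 2 W.tamagawaProduct = 1 →
      ∃ (K : Type) (_ : Field K) (_ : NumberField K),
        IsImaginaryQuadratic K ∧ (∃ ℓ : ℕ, ℓ.Prime ∧ NumberField.discr K = -(ℓ : ℤ)) ∧ Odd (NumberField.discr K) ∧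
        NumberField.discr K ≠ -3 ∧ SatisfiesHeegnerHypothesis (W.conductorNorm ℤ) K ∧
        ∃ (Dt : ModularParametrizationData W (W.conductorNorm ℤ)) (β : ℤ) (ι : K →+* ℂ) (d₁ : KolyvaginHeegnerData Dt β ι 1),
          Dt.c ≠ 0 ∧ ¬ IsOfFinAddOrder d₁.derivedPoint ∧
          (∃ Q : (W.baseChange (ringClassField K ι 1)).toAffine.Point,
            ((2 ^ (padicValInt 2 Dt.c + 1) : ℕ) : ℤ) • Q = d₁.derivedPoint) ∧
          (¬ ∃ Q : (W.baseChange (ringClassField K ι 1)).toAffine.Point,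
            ((2 ^ (padicValInt 2 Dt.c + 1 + 1) : ℕ) : ℤ) • Q = d₁.derivedPoint) ∧
          ∃ (Wd : WeierstrassCurve ℚ) (_ : Wd.IsElliptic) (_ : Wd.IsGloballyMinimal),
            (∃ C : WeierstrassCurve.VariableChange ℚ, C • W.quadraticTwist (NumberField.discr K : ℚ) = Wd) ∧
            Nat.card (Wd.selmerGroup 2) = 1)
    (hL : EntireLFunctionRat)
    (hGZ : GrossZagierAllLevels) (hGZK : MultPublishedInputsAtTwo) (hMi : MilneAnyModel) :
    NonCMAtTwo :=
  Slices.nonCMAtTwo_of_items_of_tamagawaSlicedTwin hP hPG hQ1 hQ2 hQ5R hQ3RT hQ4T hGf hR hOff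
    (hTw0_of_wall_of_reversedSupplyExponent_of_facts hGZ hGZK hL hMi hS1 hS2e)
    (hTw1_of_wall_of_reversedSupplyDepthOnePrime_of_facts hGZ hGZK hL hMi hS1 hS2p) hL hGZ hGZK hMi

end Summit.BirchSwinnertonDyer.BirchSwinnertonDyer.Theorems.GenusExact.TwinSwap.Ledger

end
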